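import Summits.HodgeConjecture.CorCM.MultiFieldWeilCrossDegreeMovers
import Mathlib.Data.Nat.Prime.Factorial
import HarnessLib

/-!
# MULTI-FIELD WEIL ENGINE — INTO A SLOT OF PRIME SIZE FROM ANY SMALLER SLOT, STABILISER-TRANSITIVITY IS FREE

Cell `pub-hodgecm2` (COR-CM), seat b30 gen 38 (2026-08-25); count-neutral own lane MULTI-FIELD WEIL ENGINE (stem `MultiFieldWeil*`), a footnote to
`CorCM/MultiFieldWeilCrossDegreeMovers.lean` (Y2) and `CorCM/MultiFieldWeilQuarticSlotMovers.lean` (Z2).  Theorems only; no definition, no named fact, no `sorry`; group theory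
and its reading on the realised tuples.  `HC_CM` is NOT touched.

THE STATEMENT (`stabTransitive_into_prime_of_lt`).  `R ⊆ ∏_l Sym(n_l)` closed under products and inverses, non-empty, transitive on the slot `m` of PRIME size `n_m`, and
`n_{m₀} < n_m`.  Then the tuples of `R` trivial at `m₀` are TRANSITIVE on the slot `m`: a mover exists because `n_m ∣ |G_m|` would otherwise divide `|G_{m₀}| ∣ n_{m₀}!`,
impossible for a prime `n_m > n_{m₀}` (Mathlib `Nat.Prime.dvd_factorial`; Y2 `not_ker_le_ker_of_not_dvd_factorial`), and one mover suffices on a slot of prime size (W1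
`stabTransitive_of_mover_prime`).  This is the uniform form of Y2's `3 → 5` and Z2's `4 → 5` (and gives `3, 4, 5, 6 → 7`, … should such slots ever acquire a Weil-space input).
Realised: `stabTransitive_realisedTuples_into_prime_of_lt`; automorphism form `exists_aut_fix_comp_eq_into_prime_of_lt` — for CM fields `K_{m₀}`, `K_m` through the imaginary
quadratic `k` with `[K_m : k]` prime and `[K_{m₀} : k] < [K_m : k]`, NO hypothesis relating the two fields.

[cite: DixonMortimer1996, §1.6, Thm. 1.6A] [cite: Shimura1998, §18.2 Lemma (i)] [cite: Lang2002, VI §1 Cor. 1.6]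

## References
* [DixonMortimer1996] J. D. Dixon, B. Mortimer, *Permutation Groups*, GTM 163, §1.6, Thm. 1.6A.  [Shimura1998] G. Shimura, *Abelian varieties with complex multiplication and
  modular functions*, §18.2 Lemma (i).  [Lang2002] S. Lang, *Algebra*, GTM 211, VI §1 Cor. 1.6.
-/

noncomputable section

open CategoryTheory CategoryTheory.Limits NumberField IntermediateField

namespace Summit.HodgeConjecture.CorCM.MultiFieldWeil

open Finset
open Literature.NumberTheory.ComplexMultiplication
open Summit.HodgeConjecture.CorCM.Census.MultiFieldWeil

open scoped Classical

/-! ## §1 Model -/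

section Model

variable {r : ℕ} {n : Fin r → ℕ} {R : Finset (PermsG n)}

/-- **A MOVER INTO A SLOT OF PRIME SIZE FROM ANY SMALLER SLOT.**  `R ⊆ ∏_l Sym(n_l)` closed under products and inverses, non-empty, transitive on the slot `m` of PRIME size
`n_m > n_{m₀}`: some tuple of `R` trivial at `m₀` moves a position of the slot `m` (`n_m ∣ |G_m|` but `n_m ∤ n_{m₀}!`). [cite: DixonMortimer1996, §1.6] -/
theorem exists_mover_into_prime_of_lt (hmul : ∀ π ∈ R, ∀ π' ∈ R, π * π' ∈ R) (hinv : ∀ π ∈ R, π⁻¹ ∈ R) (hne : R.Nonempty) {m₀ m : Fin r}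
    (hp : (n m).Prime) (hlt : n m₀ < n m) (htr : ∀ a a' : Fin (n m), ∃ π ∈ R, π m a = a') : ∃ a : Fin (n m), ∃ ν ∈ R, ν m₀ = 1 ∧ ν m a ≠ a := by
  classical
  by_contra hno
  push Not at hno
  let Gs : Subgroup (PermsG n) :=
    { carrier := ↑R
      mul_mem' := fun {π π'} hπ hπ' => hmul π hπ π' hπ'
      one_mem' := one_mem_of_closed hmul hinv hne
      inv_mem' := fun {π} hπ => hinv π hπ }
  let ev : ∀ l : Fin r, ↥Gs →* Equiv.Perm (Fin (n l)) := fun l => (Pi.evalMonoidHom (fun l : Fin r => Equiv.Perm (Fin (n l))) l).comp Gs.subtype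
  have hev : ∀ (l : Fin r) (g : ↥Gs), ev l g = (g : PermsG n) l := fun l g => rfl
  have htr' : ∀ x y : Fin (n m), ∃ g : ↥Gs, ev m g x = y := fun x y => by
    obtain ⟨π, hπ, h⟩ := htr x y
    exact ⟨⟨π, hπ⟩, h⟩
  have hker : (ev m₀).ker ≤ (ev m).ker := fun g hg => by
    rw [MonoidHom.mem_ker, hev] at hg ⊢
    ext a
    exact congrArg Fin.val (hno a (g : PermsG n) g.2 hg)
  haveI : Nonempty (Fin (n m)) := ⟨⟨0, hp.pos⟩⟩
  have hdvd : n m ∣ (ev m).ker.index := by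
    have h := card_dvd_index_ker_of_transitive (ev m) htr'
    rwa [Nat.card_eq_fintype_card, Fintype.card_fin] at h
  refine not_ker_le_ker_of_not_dvd_factorial (ev m₀) (ev m) hdvd ?_ hker
  rw [Fintype.card_fin, hp.dvd_factorial]
  omega

/-- **INTO A SLOT OF PRIME SIZE FROM ANY SMALLER SLOT, STABILISER-TRANSITIVITY IS FREE.**  `R` closed under products and inverses, non-empty, transitive on the slot `m` of PRIME
size `n_m > n_{m₀}`: the tuples of `R` trivial at `m₀` are TRANSITIVE on the slot `m` (a mover, then blocks of prime size — W1 `stabTransitive_of_mover_prime`).  Uniform form of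
`3 → 5` (Y2) and `4 → 5` (Z2). [cite: DixonMortimer1996, §1.6, Thm. 1.6A] -/
theorem stabTransitive_into_prime_of_lt (hmul : ∀ π ∈ R, ∀ π' ∈ R, π * π' ∈ R) (hinv : ∀ π ∈ R, π⁻¹ ∈ R) (hne : R.Nonempty) {m₀ m : Fin r}
    (hp : (n m).Prime) (hlt : n m₀ < n m) (htr : ∀ a a' : Fin (n m), ∃ π ∈ R, π m a = a') (a a' : Fin (n m)) : ∃ ν ∈ R, ν m₀ = 1 ∧ ν m a = a' :=
  stabTransitive_of_mover_prime hmul hinv hne hp htr (exists_mover_into_prime_of_lt hmul hinv hne hp hlt htr) a a'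

end Model

/-! ## §2 Realised tuples and the automorphism form -/

section Realised

variable {I : Type} {r : ℕ} {Kf : I → Type} [∀ i, Field (Kf i)] [∀ i, NumberField (Kf i)] {i₀ : I} {is : Fin r → I} {n : Fin r → ℕ}
  {e : ∀ m : Fin r, (Kf (is m) →+* ℂ) ≃ Fin (n m) × Bool} {τ : Kf i₀ →+* ℂ} {im : ∀ m : Fin r, Kf i₀ →+* Kf (is m)}
  (he_sign : ∀ (m : Fin r) (s : Kf (is m) →+* ℂ), (e m s).2 = true ↔ s.comp (im m) = τ)

include he_sign in
/-- **REALISED: into a slot of prime size from any smaller slot, the realised tuples trivial at the smaller slot are transitive — no hypothesis on the fields.**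
[cite: Shimura1998, §18.2 Lemma (i)] [cite: DixonMortimer1996, §1.6, Thm. 1.6A] -/
theorem stabTransitive_realisedTuples_into_prime_of_lt (m₀ m : Fin r) (hp : (n m).Prime) (hlt : n m₀ < n m) (a a' : Fin (n m)) :
    ∃ ν ∈ realisedTuples e τ, ν m₀ = 1 ∧ ν m a = a' :=
  stabTransitive_into_prime_of_lt (fun _ hπ _ hπ' => mul_mem_realisedTuples e τ hπ hπ') (fun _ hπ => inv_mem_realisedTuples hπ) (realisedTuples_nonempty (e := e) he_sign)
    hp hlt (fun b b' => transitive_realisedTuples (e := e) he_sign m b b') a a'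

end Realised

section Aut

variable {I : Type} {r : ℕ} {Kf : I → Type} [∀ i, Field (Kf i)] [∀ i, NumberField (Kf i)] [∀ i, IsCMField (Kf i)]
  {i₀ : I} {is : Fin r → I} {n : Fin r → ℕ} {τ : Kf i₀ →+* ℂ}

/-- **CM FIELDS `K_{m₀}`, `K_m ∋ k` WITH `[K_m : k]` PRIME AND `[K_{m₀} : k] < [K_m : k]`: THE `hST` BINDER FOR THE PAIR `(m₀, m)` FOR FREE.**  For all `τ`-embeddings `s, s'` of `K_m`
some automorphism of `ℂ` over `τ(k)` fixes every `τ`-embedding of `K_{m₀}` and carries `s` to `s'`. [cite: Shimura1998, §18.2 Lemma (i)] [cite: DixonMortimer1996, §1.6, Thm. 1.6A]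
[cite: Lang2002, VI §1 Cor. 1.6] -/
theorem exists_aut_fix_comp_eq_into_prime_of_lt (h2 : Module.finrank ℚ (Kf i₀) = 2) (hdeg : ∀ l : Fin r, Module.finrank ℚ (Kf (is l)) = 2 * n l)
    (im : ∀ l : Fin r, Kf i₀ →+* Kf (is l)) (m₀ m : Fin r) (hp : (n m).Prime) (hlt : n m₀ < n m)
    (s s' : Kf (is m) →+* ℂ) (hs : s.comp (im m) = τ) (hs' : s'.comp (im m) = τ) :
    ∃ ρ : ℂ ≃+* ℂ, (ρ : ℂ →+* ℂ).comp τ = τ ∧ (∀ u : Kf (is m₀) →+* ℂ, u.comp (im m₀) = τ → (ρ : ℂ →+* ℂ).comp u = u) ∧ (ρ : ℂ →+* ℂ).comp s = s' := by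
  have hττ : ComplexEmbedding.conjugate τ ≠ τ := QuarticCM.conjugate_ne τ
  have hk : ∀ σ : Kf i₀ →+* ℂ, σ = τ ∨ σ = ComplexEmbedding.conjugate τ := fun σ => QuarticCM.eq_or_eq_conjugate_of_quadratic h2 τ σ
  have hfr : ∀ l : Fin r, ∃ e : (Kf (is l) →+* ℂ) ≃ Fin (n l) × Bool, (∀ t, (e t).2 = true ↔ t.comp (im l) = τ) ∧
      ∀ t, e (ComplexEmbedding.conjugate t) = ((e t).1, !(e t).2) := fun l => exists_signFrame (hdeg l) h2 (im l) hττ hk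
  choose e he_sign _ using hfr
  have hsymm : ∀ (l : Fin r) (t : Kf (is l) →+* ℂ), t.comp (im l) = τ → (e l).symm ((e l t).1, true) = t := fun l t ht => by
    rw [show ((e l t).1, true) = e l t from Prod.ext rfl ((he_sign l t).2 ht).symm, Equiv.symm_apply_apply]
  obtain ⟨ν, hν, hν₀, hνa⟩ := stabTransitive_realisedTuples_into_prime_of_lt (e := e) he_sign m₀ m hp hlt (e m s).1 (e m s').1
  obtain ⟨ρ, hρτ, hρ⟩ := (mem_realisedTuples e τ ν).1 hν
  refine ⟨ρ, hρτ, fun u hu => ?_, ?_⟩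
  · have h := hρ m₀ (e m₀ u).1
    rwa [hν₀, hsymm m₀ u hu, Equiv.Perm.one_apply, hsymm m₀ u hu] at h
  · have h := hρ m (e m s).1
    rwa [hνa, hsymm m s hs, hsymm m s' hs'] at h

end Aut

end Summit.HodgeConjecture.CorCM.MultiFieldWeil

end
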